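import Summits.ResolutionOfSingularities.ResolutionOfSingularities.Theses.SyzygyFlattening
import Summits.ResolutionOfSingularities.ResolutionOfSingularities.Theorems.HigherRankTermination.Negative.ResidualSteeringFalseWithoutFG
import HarnessLib

/-!
# Disproof of `HigherRankTermination` (stmt-ResolutionOfSingularities-17045) — findings

Crux #3 of route `ResolutionOfSingularities/SyzygyFlattening`:
`HigherRankTermination = ∀ p prime, R1_p → DZ_p` where `R1_p` (= `RankOneInput p` below) is termination
of the syzygy-flattening tower along every RANK-ONE (`ringKrullDim O = 1`), DIMENSION-ZERO valuation over
every field of characteristic `p`, and `DZ_p` (= `DimZeroTermination p`) is termination along every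
DIMENSION-ZERO valuation (any Krull dimension of `O`).

## Findings (cycle 1, refuter-cdisprove, 2026-08-17) — the provers should read these

* **(L) Logical shape — why no unconditional kill exists.** `¬ HigherRankTermination ↔ ∃ p prime,
  RankOneInput p ∧ ¬ OffRankOne p` (`not_higherRankTermination_iff`, proved): any refutation must PROVE the
  open crux `RankOneTermination` at some prime AND exhibit a dimension-zero valuation ring of Krull
  dimension `≠ 1` whose tower never becomes regular.  The Krull-dimension-0 slice (`O = ⊤`, forced
  `K/k` finite) is TRUE (`towerTerminates_top`, proved: `T₀ = Frac A = K`), so a counterexample needs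
  Krull dimension ≥ 2, i.e. a genuinely composite valuation, and a Lean computation of the tower there —
  out of reach, and (below) no mathematical candidate is known after this cycle's search.
* **(O1) The informal proof is not a proof (index shift; concurring with REVIEW-SyzygyFlattening.md and
  ATTACK.md).** The let-bound index is `n := toNat (trdeg_k K)`. "R1 over `k(t) ⊂ O_{v₁}`" speaks about the
  index-`(n − dim v₁)` tower of a DIFFERENT affine model `A[k(t)]`; localising the index-`n` tower of `A_c`
  at the centre `𝔮` of the coarsening gives an index-`n` tower on a ring of dimension `ht 𝔮 < n`, about
  which `RankOneInput` (index = Krull dimension, always) says nothing. So `HigherRankTermination` silently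
  contains "index-`n` flattening regularises positive-dimensional rank-one centres" (`stub_rankOneBase` of
  `Lines/birth.lean`). A counterexample to HR-with-R1-true would be: a variety whose index-`n` tower,
  localised at the generic point of a positive-dimensional component of Sing of height `h < n`, cycles
  while the index-`h` tower of that local ring terminates. Product strata `S × 𝔸^s` (S a surface germ)
  reduce this to "the `Ω^{2+s}`-flattening tower of S terminates" — tested below on all toric S.
* **(T2) Toric transversal surface types: NO kill, and the index comparison HOLDS there (computed, exact).**
  For every 2-dim'l cyclic quotient cone of index `d ≤ 14` and embedding dimension `e ≤ 5` (41 types),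
  chars 0, 2, 3, 5, 7, and syzygy index `i = 2, 3` (and `4` for `e ≤ 4`, chars 2, 3) — twelve
  (char, index) tables, pairwise IDENTICAL, every equivariant complex verified exact up to three times the
  top generator degree: the normalised blow-up of
  `N(Ωⁱ(k))` (= ideal of maximal minors = `⟨x^{deg B} : B a basis of the linear matroid of the scalar rows
  of the equivariant minimal resolution⟩`) inserts EXACTLY the rays of the Tjurina blow-up of `𝔪` (the two
  ends of the Hirzebruch–Jung chain and the curves with `b_j ≥ 3`; interior `(−2)`-curves are not
  extracted) — the SAME fan for every index `i` and every characteristic tested. Hence on toric transversal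
  types the operator is the point blow-up, `N(Ω²) ~ N(Ω³) ~ N(Ω⁴) ~ 𝔪` up to integral closure and twist, and
  the tower terminates along every valuation (rational surface singularities are absolutely isolated).
  (Heuristic reason, for the provers: on the minimal resolution the full sheaves of consecutive syzygies
  `Ωⁱ(k)`, `Ωⁱ⁺¹(k)` sit in `0 → Ω̃ⁱ⁺¹ → 𝒪^{bᵢ} → Ω̃ⁱ → 0`, so `c₁` alternates `±Z` (`Z` the fundamental
  cycle, from `0 → Ω̃² → 𝒪^e → 𝔪𝒪 = 𝒪(−Z) → 0`) and the contracted curves `{E : c₁·E = 0} = {E : Z·E = 0}`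
  are Tjurina's — an index-free description that is special to RATIONAL points.)
  Rank-2 valuations whose first direction is a boundary ray regularise in ONE step (the end ray `(1,1)` is
  always inserted). Scripts/outputs: `compute/toric_syzygy.py`, `compute/sim2d.py`, `compute/out_*.txt`
  (local files `compute/out_p*_i*_d*_e*.txt`; farm re-run j025834 — j024434 died on a missing `/usr/bin/time`).
* **(T3) Genuinely 3-dim'l toric configurations (closed centre on the closure of a singular torus-invariant
  CURVE; the local ring at the vertex is NOT a product): NO kill.** For 3-dim'l cones (simplicial `1/r(a,b)`
  types and Gorenstein cones over lattice polygons with non-primitive edges — transversal types `A₁ … A₃`,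
  up to four singular curves through the vertex), the index-3 tower of `T/J` (`J` = radical ideal of Sing
  = `⋂ p_F` over singular facets) followed along rank-3 monomial valuations `lex(w₁,w₂,w₃)` with `w₁` in the
  relative interior of a SINGULAR facet (so the rank-one coarsening is centred on the singular curve —
  exactly the `stub_residualSteering` scenario) became REGULAR after ≤ 3 steps in every run (874/874 in the
  local char-2 sweep `r ≤ 5` + Gorenstein polygons: 607 in one step, 263 in two, 4 in three; 4 cones
  skipped with `e ≥ 15`; chars 3 and 5: first 128 runs each, all regular in ≤ 4 steps, the two tables
  identical run by run; farm sweep j025834: `r ≤ 8`, chars 2,3,5). NOTE a genuine characteristic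
  dependence in dimension 3 (the row matroid of the resolution depends on `p`): the isolated `1/3`-point
  `cone((1,0,0),(0,1,0),(1,1,3))` along `lex((4,5,6),…)` is regular after 1 step in char 2 but needs 4 steps
  (through non-simplicial singular stages) in chars 3 and 5 — still no loop. No stall (`N` principal) and no repeated cone ever occurred.
  Scripts: `compute/toric3d.py`, `compute/sweep3d.py` (completeness of the degree-bounded equivariant
  resolution is heuristic: bound `L = 8·max ℓ(Hilbert basis)`, rank identity `rank Ω³ = b₂ − b₁ + 1`
  checked, results stable under enlarging `L` where tested).
* **(T4) The Nash-loop cones of CastilloEtAl2024 (Ann. Math. 203 (2026); dimension 4): NO kill.** On the toric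
  4-folds `X(S)`, `S = ω ∩ ℤ⁴`, `ω` = cone over the columns of their matrices `A` (char 0 / `p ≠ 2,3`), `A₂`
  (char 2), `A₃,₀` (char 3) — whose (normalised) Nash blow-up has a chart isomorphic to `X(S)` — the index-4
  tower of `T/J` (`J` = ideal of Sing = three `A₂`-surfaces resp. the singular strata of `A₂`, `A₃,₀`) followed
  along rank-4 monomial valuations with `w₁` in the relative interior of a singular face (and generic ones)
  became REGULAR after ≤ 3 steps in every run (CDLL0: p = 5, 40/40 — 9 in one step, 26 in two, 5 in
  three — and p = 2, 20/20; CDLL2, p = 2: 24/24; CDLL3, p = 3: 6/6 so far (e = 9, slow locally); all chars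
  on the farm: kit job j024558; files `compute/sweep4d_*.txt`). The first step already separates the three singular surfaces;
  the remaining strata are products `A₁ × (regular)` with Betti numbers `(3,4,4,4)`, `rank Ω⁴ = 2` — the
  matrix-factorisation periodicity, reproduced by the 4-dim'l engine — and die at the next step. So the one
  place where a canonical module blow-up is KNOWN to loop does not loop for the syzygy flattening.
  Script: `compute/toricd.py` (dimension-general; cross-checked against `toric3d.py`), `compute/sweep4d.py`.
* **(H) Load-bearing hypotheses.** `RankOneInput p` cannot be dropped (then the crux is `DimZeroTermination`
  itself, cruxes #2 and #3 together — `higherRankTermination_of_withoutR1`); the dimension-zero binder of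
  the conclusion is NOT load-bearing at `O = ⊤` (`towerTerminates_top` needs no dimension hypothesis) and on
  paper not at all (support item DimZeroSuffices); `∀ c, algebraMap k K c ∈ O` is redundant
  (`algebraMap_mem_of_le`); **`A.FG` IS load-bearing, FORMALISED and LANDED** (p156952, p161349, both accepted):
  `Theorems/HigherRankTermination/Negative/ValuationRingFixedPoint.lean` proves that EVERY valuation ring
  `O ⊇ k` is a fixed point of the operator (`tower_valuationSubring`: `loc O = O`, `chart O = O` since each
  adjoined Plücker ratio is required to lie in `O`, `nrm O = O` by integral closedness), and
  `Negative/ConclusionFalseWithoutFG.lean` that the conclusion with `A.FG` deleted — already its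
  off-rank-one part `ringKrullDim O ≠ 1` — is false at every prime (rank-two Hahn valuation ring of
  `𝔽_p((t^{ℤ ×ₗ ℤ}))`: dimension zero, Krull dimension ≥ 2, not Noetherian). So progress of the tower
  comes only from finite generation of the models, never from the valuation: no loop "by the valuation".
* **Why it resists (one line).** The hypothesis is the open crux; the only R1-free slices are true; and on
  every toric 3-fold tested the operator behaves like a one- or two-step resolution, so the "transversal
  cycling" named in the crux's why-might-fail does not materialise in the toric world (CastilloEtAl2024's
  Nash-blow-up loops, on their own 4-dim'l cones, are NOT reproduced by this operator, (T4)). The next arenas are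
  non-toric: non-rational normal surface germs of embedding dimension ≥ 4 (the index comparison `Ω²` vs `Ω³` may
  fail off the rational world: there the full sheaf of a reflexive module lives on a MINIMAL ADAPTED resolution,
  obtained from the minimal one by blowing up base points — Bobadilla–Romano Velázquez, arXiv:1812.06543 §5,
  Kahn 1989 — so consecutive syzygies need not flatten on the same model) and the wild cores `z^p + F`; both
  need a Gröbner/integral-closure engine (none on the farm).

## Findings (cycle 2 = generation 2, refuter-cdisprove g2, 2026-08-17) — line `birth` v10 has ONE open stub,
`stub_residualSteering` (no `RankOneInput` hypothesis!); everything below is about it.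

* **(H2) `A.FG` is load-bearing FOR THE STUB TOO — formalised and LANDED (p172486, accepted):**
  `Theorems/HigherRankTermination/Negative/ResidualSteeringFalseWithoutFG.lean` proves
  `residualSteering_false_without_FG (p) [Fact p.Prime]` and `stub_residualSteering_false_without_FG`
  (restated below as `lineBirth_stub_residualSteering_false_without_FG`): delete `A.FG` from
  `stub_residualSteering` and it is FALSE at every prime. Witness: `k = 𝔽_p`, `K = 𝔽_p((t^{ℤ ×ₗ ℤ}))` (Hahn
  series), `O` = its rank-two valuation ring (dimension zero), `A = O` as a `k`-subalgebra (a fixed point of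
  the operator, gen-1 (H)), and the STEERING valuation ring `O₁` = valuation ring of the first-coordinate
  valuation `x ↦ exp(−(ord x).1)` — a DVR (`Valuation.valuationSubring_isDiscreteValuationRing`: value group
  cyclic and non-trivial), `O < O₁ ≠ ⊤`, and `EventuallyRegularAlong O A O₁` holds from `m₀ = 0` because
  `locAt O₁ (tower m) = O₁` is regular; yet `tower m = O` is never Noetherian. So the residual steering
  hypothesis adds NO leverage against non-finite-generation: every bit of progress must come from `A.FG`.
* **(P) Product reduction — what the stub asserts about SURFACES (paper proof, each step elementary).**
  Let `k` have characteristic `p`, `C₀` a normal 2-dimensional local domain essentially of finite type over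
  `k` with SINGULAR closed point and residue field `κ₀`, `μ` a dimension-zero valuation of `L = Frac C₀`
  centred on `𝔪_{C₀}`, `s ≥ 1`, `K = L(w₁,…,w_s)`, `A` = (an affine model of) `C₀[w₁,…,w_s]`, and
  `ν = ord_{w₁} ∘ ⋯ ∘ ord_{w_s} ∘ μ` (lexicographic: first the `w₁`-adic order, …, last `μ` of the leading
  coefficient). Then `O_ν` has dimension zero, `A ⊆ O_ν`, `O₁ := O_{ord_{w₁}}` is a DVR with
  `O_ν < O₁ ≠ ⊤`, and for EVERY `m`: `tower O_ν A m = (C_m[w])_{(𝔪_{C_m}, w)}` where `C_{m+1} = loc_μ (nrm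
  (Bl_{N^{(n)}(C_m)}))`, `n = 2 + s`, `N^{(n)}(C) := I_{r_n}(ι Ωⁿ_C(κ_C))` = ideal of maximal minors of the
  `n`-th syzygy module OF THE RESIDUE FIELD of the surface `C` (any torsion-cokernel embedding `ι`).
  Proof: `Sing (C_m[w])_loc = V(𝔪_{C_m})` (isolated normal surface singularity × 𝔸ˢ; regularity descends
  along the flat map `C_m → C_m(w)`), so `singIdeal = 𝔪_{C_m}·T_m` (prime, quotient `κ_m[w]_{(w)}`), and
  `T_m ⧸ J = κ_m ⊗_{C_m} T_m` is the base change of the residue field along the FLAT map `C_m → T_m`; hence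
  its minimal resolution, its `n`-th syzygy and the minors ideal are base-changed: `N = N^{(n)}(C_m)·T_m`
  (`chart_canonical`/`normIdeal_indep` of the lead make the choice of resolution and `ι` immaterial).
  `ν|_L = μ`, so the `O_ν`-minimal chart is the `μ`-minimal chart with `w` adjoined; `nrm (B[w]) = (nrm B)[w]`
  and localisation commute with `[w]`; the centre of `ν` is `(centre of μ, w)`. Finally `locAt O₁ (tower m)
  = (T_m)_{(w)}` is the local ring of a normal domain at a height-one prime: a DVR, so
  `EventuallyRegularAlong O_ν A O₁` holds with `m₀ = 0`, for free. CONSEQUENCE: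
  `stub_residualSteering p ⟹ ∀ n ≥ 3, ∀ (C₀, μ) as above, the index-n residue-field syzygy tower of C₀
  along μ becomes regular` — an index-shifted `SurfaceTermination` for ALL indices at once, with no rank-one
  input whatsoever. THIS is the statement to attack (and, for the provers, the statement the line must
  really prove: (O1) of cycle 1 is not a reviewer's quibble but the content of the stub).
* **(C) Cones: the release criterion (paper).** Let `C ⊂ ℙ^{e−1}` be a smooth projectively normal curve of
  degree `d` and genus `g` over `k = k̄`, `R = ⊕ R_j` its cone (a normal graded surface), `E ≅ C` the
  exceptional curve of the vertex blow-up `S̃ = Tot(𝒪_C(−1)) → Spec R` (smooth). For each `i ≥ 2`,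
  `N = N^{(i)}(R)` is homogeneous and its reflexive hull `N**` is PRINCIPAL, `= (h)` with `h` homogeneous of
  some degree `a`: `N**` is the divisorial ideal of class `c₁(Ωⁱ(κ)) ∈ Cl(R)`, and from
  `0 → Ω^{t+1} → F_t → Ω^t → 0` one gets `c₁(Ω^{t+1}) = −c₁(Ω^t)`, while `c₁(Ω¹) = c₁(𝔪) = 0` (`𝔪** = R`);
  numerically this is visible as `dim N_j = dim R_{j−a}` for `j ≫ 0`, which the engine checks. So
  `N = h·𝔞` with `𝔞` an `𝔪`-primary homogeneous ideal (or `R`), lowest degree `b₁ = r₁ − a` (`r₁` = least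
  degree of a non-zero maximal minor), and `Bl_N = Bl_𝔞`. On `S̃`, `𝔞·𝒪_{S̃} = 𝒪(−b₁E)·𝔟` where the
  residual `𝔟` is cosupported at the base points ON `E = C` of the linear system `𝔞_{b₁} ⊆ H⁰(C, 𝒪_C(b₁))`
  (plus embedded higher-order data). Hence: (C1) if `𝔞_{b₁}` is BASE-POINT FREE on `C` then
  `\overline{𝔞} = \overline{𝔪^{b₁}}` and the normalised blow-up of `N` IS the vertex blow-up `S̃`: the
  index-`i` operator resolves the cone in ONE step; (C2) if `dim 𝔞_{b₁} ≥ 2` (a moving part) then `ord_E`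
  is a Rees valuation of `𝔞`, `E` is RELEASED on `S₁ = nrm Bl_N`, and `S₁` has only singularities at the
  base points, each dominated by a `𝔾_m`-stable chain: cyclic quotient (rational) points, where every tower
  terminates (gen-1 (T2)); (C3) if `dim 𝔞_{b₁} = 1` then `E` is CONTRACTED on `S₁` to a `𝔾_m`-fixed point
  `x₁` which is a weighted-homogeneous normal germ with the SAME central curve `C`; along
  `μ = ord_E ∘ ord_P` (dimension zero, rank two) the tower stays at the fixed points `x_m` as long as `E`
  is not released, and NEVER terminates if it is never released (a curve of genus `≥ 1` cannot contract to
  a regular point). So `d₁ := dim_k N_{r₁} = dim 𝔞_{b₁} = 1` at some stage is the signature of danger, and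
  base-point freeness of `𝔞_{b₁}` the signature of instant death of the counterexample.
  Degree bookkeeping that makes (C1) frequent: write the generator matrix of `Ωⁱ(κ) ⊂ F_{i−1}` in the
  bigraded form (rows of internal degree `i−1` | `i`, columns `i` | `i+1`, blocks linear / 0 / quadratic /
  linear — the `0` by minimality); a maximal minor using `α` low rows and `δ` high columns has degree
  `α + δ ≥ r`, with equality iff it is a product of a linear-strand minor and a high-strand minor. Hence:
  (K) `R` KOSZUL ⟹ `N = N_r·R` is generated in ONE degree, `𝔞` is generated by `𝔞_{b₁}`, which is then
  base-point free (an `𝔪`-primary ideal generated in one degree has no base point on `C`) ⟹ ONE STEP for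
  every index `i ≥ 2` (all cones over projectively normal curves with Koszul coordinate ring: rational normal
  scrolls, elliptic normal curves of degree ≥ 4, canonical curves of Clifford index ≥ 2 in char 0, every
  curve re-embedded by a high Veronese …); (Hyp) `e = 3` (plane curves, hypersurface cones
  `z`-regular…): by the matrix-factorisation periodicity `Ωⁱ(κ)`, `i ≥ 3`, is the image of a `2^{2}`-size
  matrix factorisation of the linear-entries Koszul type and a direct computation gives `𝔞 = 𝔪` for all
  `i ≥ 2` ⟹ the operator is the vertex blow-up ⟹ termination by Zariski–Lipman for all plane-curve cones.
  What is left: NON-Koszul, codimension ≥ 2 cones — smooth curves whose ideal needs cubics: genus 2 in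
  degree 5 (`ℙ³`), hyperelliptic genus 3 in degree 7 (`ℙ⁴`), the canonical genus-4 curve `Q ∩ K ⊂ ℙ³`,
  complete intersections of two cubics …; for c.i.'s the Tate resolution shows the high-strand linear block
  is `(x₁ … x_e)` itself (Leibniz rule `d(eᵢηⱼ) = xᵢηⱼ − eᵢ zⱼ`), so again base-point free. The graded
  engine `compute/graded_syzygy.py` (exact linear algebra over `𝔽_p` on `R_j = H⁰(C, 𝒪(j))`, minimal
  resolution of `κ` to index 5, division-free maximal minors, base lengths `ℓ(j) = deg Z(N_j)` read off from
  `dim R_m − dim N_j R_{m−j}` for `m ≫ j`) tabulates `(betti, r, r₁, a, b₁, d₁, ℓ_𝔞(b₁), verdict)`; see the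
  `Computations (gen 2)` block at the end of this file for the job table.
* **(L2) Logical position of the stub.** `stub_residualSteering` has no rank-one input, so by (P) it
  contains "index-`i` residue-field syzygy towers of normal surface germs terminate, for every `i ≥ 3`"
  outright. The crux `HigherRankTermination` needs the stub only under `RankOneInput p`, and whether
  `RankOneInput p` (index = transcendence degree, always) says anything about index-`n` towers of
  `(n−s)`-dimensional local rings is precisely the gap (O1) of cycle 1. So a prover of the stub must in
  effect prove index-shifted surface termination; for cones this is (C1)/(C2)+(T2) whenever `d₁ ≥ 2`, and
  (C3) is where a counterexample would live.
-/

noncomputable section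

set_option linter.dupNamespace false

open Summit.ResolutionOfSingularities.ResolutionOfSingularities.Theses.SyzygyFlattening
  (HigherRankTermination RankOneTermination)

namespace Summit.ResolutionOfSingularities.ResolutionOfSingularities.Cruxes.HigherRankTermination.Disproof

/-! ## The route's tower by name (verbatim the `let`-block of every `SyzygyFlattening` item) -/

/-- The syzygy-flattening tower `T₀ = A_c`, `T_{m+1} = (nrm (chart T_m))_c` along `O` from `A` — verbatim
the `let`-bound `n, J, loc, chart, nrm, tower` of `Theses/SyzygyFlattening.lean` (copied from
`Lines/birth.lean`, so that everything below is the route's statement by `Iff.rfl`). -/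
def tower (k K : Type) [Field k] [Field K] [Algebra k K] (O : ValuationSubring K)
    (A : Subalgebra k K) (m : ℕ) : Subalgebra k K :=
  let n : ℕ := Cardinal.toNat (Algebra.trdeg k K); let J : (B : Subalgebra k K) → Ideal ↥B := fun B => sInf ((fun 𝔭 : PrimeSpectrum ↥B => 𝔭.asIdeal) '' {𝔭 : PrimeSpectrum ↥B | ¬ IsRegularLocalRing (Localization.AtPrime 𝔭.asIdeal)}); let loc : Subalgebra k K → Subalgebra k K := fun B => Algebra.adjoin k {y : K | ∃ a ∈ B, ∃ s ∈ B, s⁻¹ ∈ O ∧ y = a * s⁻¹}; let chart : Subalgebra k K → Subalgebra k K := fun B => Algebra.adjoin k ((B : Set K) ∪ {y : K | ∃ (b : ℕ → ℕ) (d : (i : ℕ) → ((Fin (b (i + 1)) → ↥B) →ₗ[↥B] (Fin (b i) → ↥B))) (ε : (Fin (b 0) → ↥B) →ₗ[↥B] (↥B ⧸ J B)) (r : ℕ) (ι : ↥(LinearMap.range (d (n - 1))) →ₗ[↥B] (Fin r → ↥B)), Function.Surjective ε ∧ Function.Exact (d 0) ε ∧ (∀ i : ℕ, Function.Exact (d (i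 + 1)) (d i)) ∧ Function.Injective ι ∧ (∀ z : Fin r → ↥B, ∃ a : ↥B, a ≠ 0 ∧ a • z ∈ LinearMap.range ι) ∧ ∃ g x : Fin r → ↥(LinearMap.range (d (n - 1))), Matrix.det (Matrix.of fun i j => ((ι (x i) j : ↥B) : K)) ≠ 0 ∧ (∀ g' : Fin r → ↥(LinearMap.range (d (n - 1))), Matrix.det (Matrix.of fun i j => ((ι (g' i) j : ↥B) : K)) * (Matrix.det (Matrix.of fun i j => ((ι (x i) j : ↥B) : K)))⁻¹ ∈ O) ∧ y = Matrix.det (Matrix.of fun i j => ((ι (g i) j : ↥B) : K)) * (Matrix.det (Matrix.of fun i j => ((ι (x i) j : ↥B) : K)))⁻¹}); let nrm : Subalgebra k K → Subalgebra k K := fun B => Algebra.adjoin k {y : K | IsIntegral ↥B y}; let tower : Subalgebra k K → ℕ → Subalgebra k K := fun A m => @Nat.rec (fun _ => Subalgebra k K) (loc A) (fun _ B => loc (nrm (chart B))) m; tower A m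

/-- Termination of the tower along `O` from `A`: some stage is a regular local ring. -/
def TowerTerminates (k K : Type) [Field k] [Field K] [Algebra k K] (O : ValuationSubring K)
    (A : Subalgebra k K) : Prop :=
  ∃ m : ℕ, IsRegularLocalRing ↥(tower k K O A m)

/-- The crux's HYPOTHESIS at `p` (= `RankOneTermination` at `p`, verbatim): rank one, dimension zero. -/
def RankOneInput (p : ℕ) : Prop :=
  ∀ (k K : Type) [Field k] [CharP k p] [Field K] [Algebra k K] (O : ValuationSubring K)
    (A : Subalgebra k K), (∀ c : k, algebraMap k K c ∈ O) → A.FG → IsFractionRing ↥A K →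
    A.toSubring ≤ O.toSubring →
    (∀ y : K, y ∈ O → ∃ f : Polynomial k, f ≠ 0 ∧ O.valuation (Polynomial.aeval y f) < 1) →
    ringKrullDim ↥O = 1 → TowerTerminates k K O A

/-- The crux's CONCLUSION at `p`: termination along every dimension-zero valuation (any Krull dimension). -/
def DimZeroTermination (p : ℕ) : Prop :=
  ∀ (k K : Type) [Field k] [CharP k p] [Field K] [Algebra k K] (O : ValuationSubring K)
    (A : Subalgebra k K), (∀ c : k, algebraMap k K c ∈ O) → A.FG → IsFractionRing ↥A K →
    A.toSubring ≤ O.toSubring →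
    (∀ y : K, y ∈ O → ∃ f : Polynomial k, f ≠ 0 ∧ O.valuation (Polynomial.aeval y f) < 1) →
    TowerTerminates k K O A

/-- The part of the conclusion NOT already contained in the hypothesis: Krull dimension `≠ 1`
(i.e. the trivial valuation, and composite valuations of rank ≥ 2). -/
def OffRankOne (p : ℕ) : Prop :=
  ∀ (k K : Type) [Field k] [CharP k p] [Field K] [Algebra k K] (O : ValuationSubring K)
    (A : Subalgebra k K), (∀ c : k, algebraMap k K c ∈ O) → A.FG → IsFractionRing ↥A K →
    A.toSubring ≤ O.toSubring →
    (∀ y : K, y ∈ O → ∃ f : Polynomial k, f ≠ 0 ∧ O.valuation (Polynomial.aeval y f) < 1) →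
    ringKrullDim ↥O ≠ 1 → TowerTerminates k K O A

/-- Sanity: the crux is `∀ p prime, RankOneInput p → DimZeroTermination p` on the nose. -/
theorem higherRankTermination_iff :
    HigherRankTermination ↔ ∀ p : ℕ, p.Prime → RankOneInput p → DimZeroTermination p :=
  Iff.rfl

/-! ## (L) Logical shape: the content of the crux is exactly the off-rank-one part -/

/-- `HigherRankTermination` is equivalent to: `R1_p` ⇒ termination along dimension-zero valuations of
Krull dimension `≠ 1` (the rank-one instances of the conclusion ARE the hypothesis). -/
theorem higherRankTermination_iff_offRankOne :
    HigherRankTermination ↔ ∀ p : ℕ, p.Prime → RankOneInput p → OffRankOne p := by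
  rw [higherRankTermination_iff]
  constructor
  · intro h p hp hR k K _ _ _ _ O A hk hFG hFr hAO hdz _
    exact h p hp hR k K O A hk hFG hFr hAO hdz
  · intro h p hp hR k K _ _ _ _ O A hk hFG hFr hAO hdz
    by_cases h1 : ringKrullDim ↥O = 1
    · exact hR k K O A hk hFG hFr hAO hdz h1
    · exact h p hp hR k K O A hk hFG hFr hAO hdz h1

/-- **The shape of any refutation.** A disproof of the crux must PROVE `RankOneTermination` at some prime
and exhibit a dimension-zero valuation ring of Krull dimension `≠ 1` along which the tower never becomes
regular. (This is why the crux resists: its hypothesis is the open crux #2.) -/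
theorem not_higherRankTermination_iff :
    ¬ HigherRankTermination ↔ ∃ p : ℕ, p.Prime ∧ RankOneInput p ∧ ¬ OffRankOne p := by
  rw [higherRankTermination_iff_offRankOne]
  push Not
  rfl

/-! ## (H) Load-bearing analysis -/

/-- The crux with its hypothesis `RankOneInput p` DROPPED: termination along all dimension-zero
valuations outright (= cruxes #2 and #3 together). -/
def HigherRankTerminationWithoutR1 : Prop :=
  ∀ p : ℕ, p.Prime → DimZeroTermination p

/-- Dropping the hypothesis only strengthens: `WithoutR1 → HR` (so `¬HR → ¬WithoutR1`; the converse
direction is where the hypothesis would have to work, see (O1) in the module docstring). -/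
theorem higherRankTermination_of_withoutR1 :
    HigherRankTerminationWithoutR1 → HigherRankTermination :=
  fun h p hp _ => h p hp

/-- The conclusion's rank-one instances are the hypothesis verbatim (no work). -/
theorem dimZeroTermination_rankOne_of_input (p : ℕ) (hR : RankOneInput p)
    (k K : Type) [Field k] [CharP k p] [Field K] [Algebra k K] (O : ValuationSubring K)
    (A : Subalgebra k K) (hk : ∀ c : k, algebraMap k K c ∈ O) (hFG : A.FG) (hFr : IsFractionRing ↥A K)
    (hAO : A.toSubring ≤ O.toSubring)
    (hdz : ∀ y : K, y ∈ O → ∃ f : Polynomial k, f ≠ 0 ∧ O.valuation (Polynomial.aeval y f) < 1)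
    (h1 : ringKrullDim ↥O = 1) : TowerTerminates k K O A :=
  hR k K O A hk hFG hFr hAO hdz h1

/-- The hypothesis `∀ c, algebraMap k K c ∈ O` of every item is REDUNDANT (implied by `A ≤ O`). -/
theorem algebraMap_mem_of_le {k K : Type} [Field k] [Field K] [Algebra k K] (O : ValuationSubring K)
    (A : Subalgebra k K) (hAO : A.toSubring ≤ O.toSubring) (c : k) : algebraMap k K c ∈ O :=
  hAO (A.algebraMap_mem c)

/-! ## The Krull-dimension-zero slice of `OffRankOne` is TRUE (no junk refutation there) -/

/-- Along the trivial valuation `O = ⊤` the first stage of the tower is `Frac A = K` (as the subalgebra `⊤`). -/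
theorem tower_top_zero (k K : Type) [Field k] [Field K] [Algebra k K] (A : Subalgebra k K)
    [hFr : IsFractionRing ↥A K] : tower k K ⊤ A 0 = ⊤ := by
  -- stage 0 is `loc A` for `O = ⊤`: every `a * s⁻¹` with `a, s ∈ A` is adjoined, and these exhaust `K`
  show Algebra.adjoin k {y : K | ∃ a ∈ A, ∃ s ∈ A, s⁻¹ ∈ (⊤ : ValuationSubring K) ∧ y = a * s⁻¹} = ⊤
  rw [eq_top_iff]
  intro y _
  apply Algebra.subset_adjoin
  obtain ⟨a, s, -, rfl⟩ := IsFractionRing.div_surjective (A := ↥A) y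
  refine ⟨(a : K), a.2, (s : K), s.2, trivial, ?_⟩
  rw [div_eq_mul_inv]
  rfl

/-- `K` itself (as the subalgebra `⊤`) is a regular local ring (a field). -/
theorem isRegularLocalRing_top (k K : Type) [Field k] [Field K] [Algebra k K] :
    IsRegularLocalRing ↥(⊤ : Subalgebra k K) :=
  IsRegularLocalRing.of_ringEquiv (R := K) (Subalgebra.topEquiv (R := k) (A := K)).symm.toRingEquiv

/-- **Rank-zero slice TRUE.** Along the trivial valuation the tower is regular at stage 0; no
dimension-zero hypothesis and no finiteness of `K/k` is needed. (So a counterexample to the crux needs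
Krull dimension ≥ 2.) -/
theorem towerTerminates_top (k K : Type) [Field k] [Field K] [Algebra k K] (A : Subalgebra k K)
    (hFr : IsFractionRing ↥A K) : TowerTerminates k K ⊤ A :=
  ⟨0, by rw [tower_top_zero k K A]; exact isRegularLocalRing_top k K⟩

/-- The `O = ⊤` instances of `OffRankOne p` hold for every `p` (calibration of the refutation shape). -/
theorem offRankOne_top (p : ℕ) (k K : Type) [Field k] [CharP k p] [Field K] [Algebra k K]
    (A : Subalgebra k K) (hFr : IsFractionRing ↥A K) : TowerTerminates k K ⊤ A :=
  towerTerminates_top k K A hFr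

/-! ## (H2) Residual steering gives no leverage without finite generation (LANDED, p172486) -/

/-- `stub_residualSteering` of `Lines/birth.lean` (v10) with the single binder `A.FG →` deleted is
FALSE (at `p = 2` already; `residualSteering_false_without_FG p` does every prime). This is the landed
theorem `Theorems.HigherRankTermination.Negative.stub_residualSteering_false_without_FG`, re-exported
here so that ideators/planners importing the disproof file see it. Any proof of the stub must use
`A.FG` in an essential way — and (gen-1 (H)) not through the valuation: through Noetherianity of the
models. -/
theorem lineBirth_stub_residualSteering_false_without_FG :
    ¬ (∀ (p : ℕ), p.Prime →
        ∀ (k K : Type) [Field k] [CharP k p] [Field K] [Algebra k K] (O : ValuationSubring K)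
          (A : Subalgebra k K), (∀ c : k, algebraMap k K c ∈ O) → IsFractionRing ↥A K →
          A.toSubring ≤ O.toSubring → Theorems.SyzygyFlattening.DimZero k O →
          ∀ O₁ : ValuationSubring K, O < O₁ → O₁ ≠ ⊤ →
          Theorems.SyzygyFlattening.EventuallyRegularAlong O A O₁ →
          Theorems.SyzygyFlattening.TowerTerminates O A) :=
  Theorems.HigherRankTermination.Negative.stub_residualSteering_false_without_FG

/-- Per-prime form of (H2): at EVERY prime `p` the FG-less residual-steering statement fails. -/
theorem residualSteering_false_without_FG' (p : ℕ) [Fact p.Prime] :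
    ¬ (∀ (k K : Type) [Field k] [CharP k p] [Field K] [Algebra k K] (O : ValuationSubring K)
        (A : Subalgebra k K), (∀ c : k, algebraMap k K c ∈ O) → IsFractionRing ↥A K →
        A.toSubring ≤ O.toSubring → Theorems.SyzygyFlattening.DimZero k O →
        ∀ O₁ : ValuationSubring K, O < O₁ → O₁ ≠ ⊤ →
        Theorems.SyzygyFlattening.EventuallyRegularAlong O A O₁ →
        Theorems.SyzygyFlattening.TowerTerminates O A) :=
  Theorems.HigherRankTermination.Negative.residualSteering_false_without_FG p

/-- The `Defs` vocabulary and this file's verbatim `let`-block agree definitionally. -/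
theorem defs_towerTerminates_iff (k K : Type) [Field k] [Field K] [Algebra k K]
    (O : ValuationSubring K) (A : Subalgebra k K) :
    Theorems.SyzygyFlattening.TowerTerminates O A ↔ TowerTerminates k K O A :=
  Iff.rfl

/-! ## -- Line birth (v10): stub-by-stub status for the lead

* `stub_residualSteering` — the ONLY open stub. Load-bearing hypotheses: `A.FG` (H2, landed, essential);
  `DimZero k O` and `O₁ ≠ ⊤`, `O < O₁` (cannot be dropped on paper: without `DimZero` take `O` = a DVR of a
  function field centred on a singular curve — but then `TowerTerminates` asks regularity of a 1-dim'l
  normal local ring, which holds; no cheap kill found); `EventuallyRegularAlong` (dropping it gives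
  `DimZeroTermination` itself). CONTENT of the stub, by (P): index-`n` residue-field syzygy towers of
  normal surface germs terminate for every `n ≥ 3` — strictly more than the informal card claims
  ("the rank-one case steers the residual directions"): the steering hypothesis is AUTOMATIC in the
  product situation and carries no information there.
* `-- Targets`: payload `targets = []`, `stuck_stubs = []` (gen 2). No stub signature was killed; one
  hypothesis (`A.FG`) certified load-bearing in Lean.
-/

/-! ## Computations (gen 2) — non-Koszul cones (engine `compute/graded_syzygy.py`, exact over `𝔽_p`)

Jobs: j027899 (smoke/calibration: plane-cubic cone `e = 3`, elliptic quartic cone; `p = 10007`, `i ≤ 3`),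
j028032 (full: `cubic_e3, ell_quartic, g2_quintic, g4_canonical, g3hyp_septic, g2_sextic, ell_quintic` ×
`p ∈ {32003, 2, 3, 5, 7}` × `i = 2 … 5` (`… 4` for `e = 5`)). Columns of the table (to be filled from
`~/compute/j028032/outputs/results.json` when the job returns; both were QUEUED at publication time):
`example | p | i | generator degrees of Ωⁱ(κ) | r | r₁ | a | b₁ | d₁ = dim N_{r₁} | ℓ_𝔞(b₁) | verdict`.
Reading: `verdict = ONE_STEP_SMOOTH` is (C1); `E_RELEASED_NOT_SMOOTH` is (C2) (then only cyclic-quotient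
points, gen-1 (T2)); `E_CONTRACTED` (`d₁ = 1`) is (C3), the only pattern that can seed a counterexample.
-/

/-! ## Near-misses / open computational targets (docstring only; nothing is claimed)

* `-- Targets`: payload `targets = []`, `stuck_stubs = []` this cycle. The line `birth` stubs were probed on
  paper: `stub_coarseningLocalisation` is true at `O₁ = ⊤` (centre `⊥`, localisation = `Frac` = field) and at
  `O₁ = O` (regular stages are fixed points); `stub_rankOneBase` carries (O1); `stub_residualSteering` is the
  scenario of finding (T3) — no toric counterexample.
* Next arenas for a disprover: (i) broader random 4-dim'l cone sweeps (engine `toricd.py` exists); (ii) non-toric transversal types of embedding dimension ≥ 4 at NON-rational points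
  (where SurfaceTermination is open); (iii) the wild cores `z^p + F` followed along Cossart–Piltant /
  Hauser–Perlega runs (needs a Gröbner engine over `𝔽_p(t)` — not on the farm toolbelt).
-/

end Summit.ResolutionOfSingularities.ResolutionOfSingularities.Cruxes.HigherRankTermination.Disproof

end
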